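import Literature.MathematicalPhysics.QuantumFieldTheory.Balaban1983to89.T4Covariance
import Literature.MathematicalPhysics.QuantumFieldTheory.Balaban1983to89.T4ReflectionCone

/-!
# Bałaban's symmetric block averaging [Balaban1987RG1] (0.3)–(0.7) as a total `Setup.Averaging`, and the discharge of
# the four named hypotheses `AvgMeasurable`, `AvgPermEquivariant` (`T4Continuum`), `AvgTranslEquivariant`,
# `AvgReflEquivariant` (`T4Covariance`) for it

Cell `pub-balaban`, T4 programme row T4-D.L (kind TYPE; tree divergence F6 "abstract `Setup.Averaging` does not encode the
formulas"): the tree's `Setup.Averaging P j G` is an INTERFACE (a map `avg` with covariance and locality in the standing range)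
and `T4Continuum.FiniteEpsData.av` is DATA of that type; the torus-covariance and measurability clauses of the rung-(B)+1
targets were reduced in `T4Continuum` §7–8 and `T4Covariance` to four properties of `av` which the interface cannot prove and
which Bałaban's printed averaging has.  This module TYPES the SHAPE of the printed averaging — [Balaban1987RG1] §0,
(0.3)–(0.4) with the axioms (0.5)–(0.7) — as the FAMILY of inhabitants `BlockAveraging.blockAvg ℰ : Averaging P j G` (every
level `j`, total in the configuration) parametrised by an ABSTRACT small-loop average `ℰ : LoopAverage G` (§0) standing in for
the inner operation `{W_i} ↦ exp[|I|⁻¹ Σ_i log W_i]` of (0.4), and PROVES the four properties for every finite-`ε` approximation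
whose averaging maps are `blockAvg ℰ`, for EVERY small-loop average `ℰ` (§6).  The PRINTED inner operation itself is NOT
constructed in this module (cell GAPS G-adv2-25): in the tree it is the inhabitant `ExpMeanLog.expMeanLogU : LoopAverage U(N)` /
`ExpMeanLog.expMeanLogSU : LoopAverage SU(N)` of the LATER sibling module `BlockAveragingExpMeanLog` (unit b2b-balaban-pv11;
series = principal matrix logarithm on `‖W − 1‖ ≤ 1/3`, radius `min (1/3, π/N)` on `SU(N)`), for which `blockAvg expMeanLogSU` is
(0.4) literally ON the small-field domain `Small` of §3 and the axial transporter `U(c)` off it; the inhabitants available in THIS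
module are `LoopAverage.trivial` (`E ≡ 1`, for which `blockAvg` is the plain axial averaging, `avgFun_trivial`) and every
`Setup.GroupAverage` (§0), and a further sibling inhabitant on `SU(2)` is the quaternionic projected mean `su2Mean` of
`BlockAveragingSU2` (a different average with the same axioms, NOT the printed `exp[mean log]`; cell DIVERGENCE D-pv26g2.4).

WHAT IS QUOTED (from the rendered pages 252–254 and 269 of [Balaban1987RG1]; cell READING row C-pv26g2-3):
* p. 252: "Blocks of order 1 are denoted by B(y). For a point x ∈ B(y) we take a family G(y, x) of shortest contours with
  the initial point at y, and the final point at x. If x - y = Σ_{μ=1}^{d} δ n_μ e_μ (δ is a lattice spacing, n_μ an integer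
  such that |n_μ| ≦ L−1/2), then we construct contours of G(y, x) in the following way: take a permutation {π(1), π(2), …}
  of indices μ with nonzero numbers n_μ, next take |n_π(1)| bonds in the direction sign n_π(1) e_π(1) starting at y, |n_π(2)|
  bonds in the direction sign n_π(2) e_π(2) starting at y + δ n_π(1) e_π(1), and so on. We define G(y, x) as the family of
  contours generated by all such permuations. For a bond c and a point x ∈ B(c₋), let [x, x′] denote a contour which is
  obtained by a parallel transport of c to the point x." and "This definition has one disadvantage, it is not symmetric with
  respect to lattice Euclidean transformations. Preserving this symmetry is very important for the method; therefore it is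
  necessary to modify the definition."
* (0.4) p. 253: "Ū(c) = M(U, c) = exp[ i Σ_{x∈B(c₋)} L^{-d} Σ_{Γ∈G(c₋,x)} 1/|G(c₋,x)| Σ_{Γ′∈G(c₊,x′)} 1/|G(c₊,x′)| ×
  (1/i) log U(Γ ∪ [x,x′] ∪ (−Γ′) ∪ (−c)) ] U(c)."
* p. 253: "We introduce an axiomatric definition of such an average. It is a Gᶜ-valued function defined on sets
  {U_j : j = 1, 2, …, n}, U_j ∈ Gᶜ, with sufficiently small diameters. We denote it by {U_j}‾ = M({U_j}), and we assume that
  it is an analytic function having the following properties: M({U_j⁻¹}) = M({U_j})⁻¹; (0.5) M({uU_jv}) = uM({U_j})v; (0.6)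
  M(π{U_j}) = M({U_j}) for an arbitrary permutation π of the set {U_j}; (0.7)" and "The considerations and results of this,
  and previous papers, do not depend on any particular averaging operation used; they are valid universally for all averages
  satisfying the above properties."
* p. 254: "Let us stress that both definitions are equally good for our purposes, in fact we may use many other definitions.
  It is possible to axiomatize them also, listing all essential properties, but it is not interesting enough to do it here."
* (2.17) p. 269: "Now consider a Euclidean symmetry r of the torus T, preserving the torus T^{(k+1)}. We define generally
  (rU)(b) = U(rb), rb = r⟨b₋, b₊⟩ = ⟨rb₋, rb₊⟩. (2.17) By their definitions the expressions in (2.1) are invariant with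
  respect to these transformations." — the action of a Euclidean symmetry `r` of the torus on configurations (the tree's
  `GaugeField.permute` / `translate` / `creflect`, cf. `T4Covariance`).

WHAT IS TYPED, AND HOW (cell DIVERGENCE row D-pv26g2.3):
(i) §0 `LoopAverage G` — the operation `{W_i} ↦ exp[|I|⁻¹ Σ_i log W_i]` inside (0.4), AXIOMATISED by the paper's own
  (0.5)–(0.7) restricted to what (0.4) uses ((0.6) for conjugations `v = u⁻¹`: loop variables based at one point transform by
  conjugation), each axiom imposed on families within `dist1 < δ` of `1` (the domain of `log`); `Gᶜ`, analyticity, (0.8),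
  (0.9) are not encoded (they concern the analytic extension, tree divergence F4).  Inhabited here by `E ≡ 1` (`LoopAverage.trivial`)
  and by every `Setup.GroupAverage` (`GroupAverage.toLoopAverage`); by the printed `exp[mean log]` only in the later sibling module
  `BlockAveragingExpMeanLog` (`expMeanLogU`, `expMeanLogSU`), see above.
(ii) §1–2 the loops of (0.4) as WORDS over the tree's step alphabet: `Γ^σ_{y,x} = stairWord σ n` (the straight runs
  `n_{σ(1)} e_{σ(1)}, n_{σ(2)} e_{σ(2)}, …` in the order `σ`; zero runs are empty), the loop `Γ ∪ [x,x′] ∪ (−Γ′) ∪ (−c)` =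
  `loopWord L μ n σ σ′ := Γ^σ ++ (L steps +μ) ++ reverse(Γ^{σ′}) ++ (L steps −μ)` read from the block centre `emb c₋` with
  the tree's `T4Continuum.walk` / `holAt`; its images under the hyperoctahedral letter maps (`loopWord_map_permute`,
  `loopWord_map_reflect_of_ne`, `loopWord_map_reflect_self`), its closedness (`netDisp_loopWord`) and the box containing all
  its prefixes (`netDisp_take_loopWord`, whence locality).  The printed index set `{(x, Γ, Γ′)}` with weights
  `L^{-d} |G(c₋,x)|⁻¹ |G(c₊,x′)|⁻¹` is realised as the UNIFORM family over `Idx P = {0,…,L-1}^d × S_d × S_d` (`x = blockSite c₋ r`,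
  `n = r - (L-1)/2`, ALL orderings of ALL `d` indices): for each `x` every contour of `G(c₋,x)` arises from exactly
  `d!/|G(c₋,x)|` orderings, so the weights induced on distinct loops are the printed ones.
(iii) §3 `blockAvg ℰ : Averaging P j G`: `Ū(c) = corr · U(c)` with `U(c)` the straight transporter `AveragingRT.axialAvg`
  (= the holonomy of the segment `c` of the loop, `axialAvg_eq_holAt_walk`) and the correction factor `corr = ℰ(loop family)`
  ON THE SMALL-FIELD DOMAIN `Small ℰ U c` (every loop variable within `δ` of `1`) and `corr = 1` OFF IT — the total extension
  the row asks for ("a.e.-defined M(·) extended"); the guard is gauge invariant and is transported by every lattice symmetry,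
  so the total map is covariant (`avgFun_covariant`, [Balaban1985Averaging] (11)), local (`avgFun_local`) and symmetric.
  That SOME guard is necessary — a group with a central involution admits no total, symmetric, left-equivariant pair average —
  is `LoopAverage.no_total_symmetric_equivariant_pair_average`.
(iv) §4 the three lattice symmetries, at every level `j`: `avgFun_permute` (`avg (U ∘ π) = (avg U) ∘ π`), `avgFun_translate`
  (`avg (U ∘ τ_{La}) = (avg U) ∘ τ_a`), `avgFun_creflect` (`avg (c_ρ U) = c_ρ (avg U)` for the CENTRE reflections of
  `T4Covariance`; the naive `reflect` is refuted for centred blocks, `AveragingReflection.not_reflect_equivariant`).  The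
  longitudinal case rests on `loopHol_creflect_of_eq`: the reflected loop at `c` is the `Γ ↔ Γ′`-exchanged loop at the
  reflected bond `c′` traversed backwards from the other block centre, so its variable is `U(c′)⁻¹ W⁻¹ U(c′)`, and
  (0.5)–(0.7) give `corr (c_ρ U)(c) = U(c′)⁻¹ (corr U (c′))⁻¹ U(c′)` (`corr_creflect_of_eq`).
(v) §5 measurability over a `RegularGaugeGroup` for a measurable `E` (`measurable_avgFun`).
(vi) §6 for `D : T4Continuum.FiniteEpsData F G` with `D.av K j = blockAvg ℰ` for all `K, j`, ANY `ℰ`: `D.AvgPermEquivariant`,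
  `D.AvgTranslEquivariant`, `D.AvgReflEquivariant`, and — `E` measurable, `RegularGaugeGroup G` — `D.AvgMeasurable`; hence
  `D.limit_torusCovariant' ∧ D.limit_torusCovariant` outright (`limit_torusCovariant_of_blockAvg`).

NOT TYPED here: the second definition (0.11)–(0.12) p. 254 (two nested averages); the complex extension `Gᶜ` and analyticity;
(0.8), (0.9).  VALUE: kernel typing / bookkeeping of a printed DEFINITION and of four printed-formula identities about it; it
is NOT progress on any summit statement and asserts nothing about Bałaban's estimates.

REVISION LOG.  v1 p179052 (unit b2b-balaban-pv26-g2).  v2 (same unit; DOCFIX, docstring-only, no declaration touched): the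
(2.17) quotation completed and corrected to the printed angle brackets `r⟨b₋, b₊⟩ = ⟨rb₋, rb₊⟩` and "the torus T, preserving"
(v1 carried the OCR-layer round brackets — the misreading recorded on `T4Covariance` by cell GAPS C-ref5-15), the weights of
(0.4) written as the printed fractions `1/|G(c₋,x)|`, `1/|G(c₊,x′)|`, and the glyph `≦` of p. 252; all re-read on the renders
`…1987-cmp109-rg-I-small-field-p004-x2.png` (p. 252), `-p005-x2.png` (p. 253), `-p006-x2.png` (p. 254), `-p021-x2.png` (p. 269).
v3 (unit b2b-balaban-pv26-g4; DOCFIX, docstring-only, every declaration byte-identical to v2 p179075): wording repair of cell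
GAPS G-adv2-25 REPAIR (ii) — the header and the §0/§3/§6 docstrings no longer say that this module types THE printed averaging as
ONE inhabitant: they say `blockAvg ℰ` for EVERY small-loop average `ℰ` (the (0.4)-SHAPED block averaging) and name the tree's
inhabitant realising the PRINTED inner operation, `BlockAveragingExpMeanLog.expMeanLogU/SU` (p180398/p181278, which discharged
REPAIR (i) of the same row); no quotation changed, nothing re-read.
-/

noncomputable section

open MeasureTheory Filter Topology
open scoped BigOperators

namespace Literature.MathematicalPhysics.QuantumFieldTheory.Balaban1983to89

/-! ## 0. Small-loop averages: the axioms of B12 (0.5)–(0.7) for families of loop variables -/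

/-- **AXIOMATIC AVERAGE OF A FAMILY OF SMALL LOOP VARIABLES** — the operation `{W_i} ↦ exp[(1/|I|) Σ_i log W_i]` of
[Balaban1987RG1] (0.4) p. 253 (applied there to the loop variables `W = U(Γ ∪ [x,x′] ∪ (−Γ′) ∪ (−c))`), typed axiomatically in
the manner of the paper's own (0.5)–(0.7) p. 253 ("We introduce an axiomatric definition of such an average. It is a Gᶜ-valued
function defined on sets {U_j : j = 1, 2, …, n}, U_j ∈ Gᶜ, with sufficiently small diameters … M({U_j⁻¹}) = M({U_j})⁻¹; (0.5)
M({uU_jv}) = uM({U_j})v; (0.6) M(π{U_j}) = M({U_j}) for an arbitrary permutation π of the set {U_j}; (0.7)") and licensed by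
p. 254 ("both definitions are equally good for our purposes, in fact we may use many other definitions. It is possible to
axiomatize them also, listing all essential properties"): a total function `E` on nonempty finite families, with (0.5) INVERSION,
(0.6) restricted to CONJUGATION `v = u⁻¹` (the printed `exp[mean log]` is conjugation- but not two-sided-equivariant) and (0.7)
PERMUTATION invariance, each imposed only on families of loop variables within `dist1 < δ` of the identity (the domain of `log`;
off it the values of `E` are unconstrained).  Not encoded: `Gᶜ`, analyticity, (0.8), (0.9) (tree DIVERGENCE F4/F6).  Every
`Setup.GroupAverage` gives one (`GroupAverage.toLoopAverage`), and so does `E ≡ 1` (`LoopAverage.trivial`); the printed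
`exp[mean log]` itself inhabits the structure in the later sibling module `BlockAveragingExpMeanLog` (`expMeanLogU` on `U(N)`,
`expMeanLogSU` on `SU(N)`), not here. [cite: Balaban1987RG1, (0.5) p.253] -/
structure LoopAverage (G : Type*) [GaugeGroup G] where
  /-- radius of the domain on which the axioms are imposed -/
  δ : ℝ
  δ_pos : 0 < δ
  /-- the average of a nonempty finite family -/
  E : ∀ {n : ℕ}, (Fin (n+1) → G) → G
  /-- (0.5) on small families -/
  inv : ∀ {n : ℕ} (W : Fin (n+1) → G), (∀ i, dist1 (W i) < δ) → E (fun i => (W i)⁻¹) = (E W)⁻¹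
  /-- (0.6) with `v = u⁻¹` on small families -/
  conj : ∀ {n : ℕ} (W : Fin (n+1) → G), (∀ i, dist1 (W i) < δ) → ∀ u : G, E (fun i => u * W i * u⁻¹) = u * E W * u⁻¹
  /-- (0.7) on small families -/
  perm : ∀ {n : ℕ} (W : Fin (n+1) → G), (∀ i, dist1 (W i) < δ) → ∀ σ : Equiv.Perm (Fin (n+1)), E (W ∘ σ) = E W

namespace LoopAverage

variable {G : Type*} [GaugeGroup G]

/-- The trivial small-loop average `E ≡ 1` (with it the block averaging below IS the axial averaging of `AveragingRT`):
the axioms (0.5)–(0.7) do not by themselves force anything. [folklore] -/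
def trivial (G : Type*) [GaugeGroup G] : LoopAverage G where
  δ := 1
  δ_pos := one_pos
  E := fun _ => 1
  inv := fun _ _ => by simp
  conj := fun _ _ u => by simp
  perm := fun _ _ _ => rfl

/-- A family within `δ/2` of the identity has diameter `< δ` (`|W_i W_k⁻¹ - 1| ≤ |W_i - 1| + |W_k⁻¹ - 1|`). [folklore] -/
theorem familySmall_of_near_one {δ : ℝ} {n : ℕ} (W : Fin (n+1) → G) (h : ∀ i, dist1 (W i) < δ / 2) :
    FamilySmall δ W := by
  intro i k
  calc dist1 (W i * (W k)⁻¹) ≤ dist1 (W i) + dist1 (W k)⁻¹ := GaugeGroup.dist1_mul_le _ _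
    _ = dist1 (W i) + dist1 (W k) := by rw [GaugeGroup.dist1_inv]
    _ < δ / 2 + δ / 2 := add_lt_add (h i) (h k)
    _ = δ := by ring

/-- Every axiomatic group average `M` of the tree (`Setup.GroupAverage`: B12 (0.5)–(0.7) on small-diameter families) is a
small-loop average with half the radius. [cite: Balaban1987RG1, (0.5) p.253] -/
def _root_.Literature.MathematicalPhysics.QuantumFieldTheory.Balaban1983to89.GroupAverage.toLoopAverage
    (Mav : GroupAverage G) : LoopAverage G where
  δ := Mav.δ / 2
  δ_pos := half_pos Mav.δ_pos
  E := fun W => Mav.M W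
  inv := fun W h => Mav.inv W (familySmall_of_near_one W h)
  conj := fun W h u => Mav.equivariant W (familySmall_of_near_one W h) u u⁻¹
  perm := fun W h σ => Mav.perm W (familySmall_of_near_one W h) σ

/-- **NO TOTAL SYMMETRIC EQUIVARIANT AVERAGE EXISTS** (why the domain restriction "with sufficiently small diameters" of
[Balaban1987RG1] p. 253 cannot be dropped, and why a TOTAL averaging term must place its guard at a gauge-invariant level):
if `G` has a central element `z ≠ 1` with `z² = 1` (e.g. `-1 ∈ SU(2)`), no operation on PAIRS is both left-`z`-equivariant
((0.6) with `u = z`, `v = 1`) and symmetric ((0.7)) on ALL pairs — evaluate at the pair `(1, z)`: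
`M(1,z) = M(z,1) = M(z·1, z·z) = z·M(1,z)`. [folklore] -/
theorem no_total_symmetric_equivariant_pair_average {z : G} (hz : z ≠ 1) (hz2 : z * z = 1) :
    ¬ ∃ M : G → G → G, (∀ a b, M (z * a) (z * b) = z * M a b) ∧ (∀ a b, M a b = M b a) := by
  rintro ⟨M, hequi, hsymm⟩
  have h1 : M z 1 = z * M 1 z := by
    have := hequi 1 z
    rwa [mul_one, hz2] at this
  rw [hsymm z 1] at h1
  have h2 : (1 : G) * M 1 z = z * M 1 z := by rw [one_mul]; exact h1
  exact hz (mul_right_cancel h2).symm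

/-! ### Families over an arbitrary nonempty finite index type -/

variable (ℰ : LoopAverage G)

/-- A fixed enumeration of a nonempty finite index type by `Fin (|ι|-1+1)`. [folklore] -/
def enum (ι : Type*) [Fintype ι] [Nonempty ι] : ι ≃ Fin (Fintype.card ι - 1 + 1) :=
  (Fintype.equivFin ι).trans (finCongr (Nat.sub_add_cancel Fintype.card_pos).symm)

/-- The average of a family indexed by a nonempty finite type (through the fixed enumeration; on small families the value
does not depend on the enumeration, by (0.7)). [cite: Balaban1987RG1, (0.7) p.253] -/
def avg {ι : Type*} [Fintype ι] [Nonempty ι] (W : ι → G) : G :=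
  ℰ.E (W ∘ (enum ι).symm)

variable {ι : Type*} [Fintype ι] [Nonempty ι]

/-- (0.7) ⇒ REINDEXING INVARIANCE: on a small family, `avg (W ∘ f) = avg W` for every bijection `f` of the index type. [cite: Balaban1987RG1, (0.7) p.253] -/
theorem avg_reindex (W : ι → G) (hW : ∀ i, dist1 (W i) < ℰ.δ) (f : ι ≃ ι) : ℰ.avg (W ∘ f) = ℰ.avg W := by
  unfold avg
  have hsmall : ∀ i, dist1 ((W ∘ (enum ι).symm) i) < ℰ.δ := fun i => hW _
  have key := ℰ.perm (W ∘ (enum ι).symm) hsmall ((enum ι).symm.trans (f.trans (enum ι)))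
  rw [← key]
  congr 1
  funext k
  simp [Function.comp]

/-- (0.6) with `v = u⁻¹`: conjugation equivariance on small families. [cite: Balaban1987RG1, (0.6) p.253] -/
theorem avg_conj (W : ι → G) (hW : ∀ i, dist1 (W i) < ℰ.δ) (u : G) :
    ℰ.avg (fun i => u * W i * u⁻¹) = u * ℰ.avg W * u⁻¹ := by
  unfold avg
  exact ℰ.conj (W ∘ (enum ι).symm) (fun i => hW _) u

/-- (0.5): inversion on small families. [cite: Balaban1987RG1, (0.5) p.253] -/
theorem avg_inv (W : ι → G) (hW : ∀ i, dist1 (W i) < ℰ.δ) :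
    ℰ.avg (fun i => (W i)⁻¹) = (ℰ.avg W)⁻¹ := by
  unfold avg
  exact ℰ.inv (W ∘ (enum ι).symm) (fun i => hW _)

/-- The average is measurable in the family when `E` is. [folklore] -/
theorem measurable_avg [MeasurableSpace G] (hE : ∀ n, Measurable (fun W : Fin (n+1) → G => ℰ.E W)) :
    Measurable (fun W : ι → G => ℰ.avg W) := by
  unfold avg
  exact (hE _).comp (measurable_pi_lambda _ fun k => measurable_pi_apply _)

end LoopAverage

/-! ## 1. Words: reversal, staircase words, the loop words of (0.4) -/

namespace T4Continuum

/-- The letter traversed backwards. [folklore] -/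
def Letter.flip {n : ℕ} (l : Letter n) : Letter n := (l.1, !l.2)

/-- THE REVERSE WORD: the walk traversed backwards (`−Γ` of [Balaban1987RG1] (0.4)). [folklore] -/
def wordRev {n : ℕ} (w : List (Letter n)) : List (Letter n) := (w.map Letter.flip).reverse

/-- The reverse of the empty word. [folklore] -/
@[simp] theorem wordRev_nil {n : ℕ} : wordRev ([] : List (Letter n)) = [] := rfl

/-- The reverse of a word with a first letter. [folklore] -/
theorem wordRev_cons {n : ℕ} (l : Letter n) (w : List (Letter n)) : wordRev (l :: w) = wordRev w ++ [l.flip] := by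
  simp [wordRev]

/-- Reversal is an anti-homomorphism for concatenation. [folklore] -/
theorem wordRev_append {n : ℕ} (w₁ w₂ : List (Letter n)) : wordRev (w₁ ++ w₂) = wordRev w₂ ++ wordRev w₁ := by
  simp [wordRev, List.map_append, List.reverse_append]

/-- The reverse of a run is the run of the flipped letter. [folklore] -/
theorem wordRev_replicate {n : ℕ} (k : ℕ) (l : Letter n) : wordRev (List.replicate k l) = List.replicate k l.flip := by
  simp [wordRev, List.map_replicate, List.reverse_replicate]

/-- The reverse word has the opposite net displacement. [folklore] -/
theorem netDisp_wordRev {n : ℕ} (w : List (Letter n)) (κ : Fin n) : netDisp (wordRev w) κ = -netDisp w κ := by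
  induction w with
  | nil => simp [netDisp]
  | cons l w ih =>
    rw [wordRev_cons, T4ReflectionCone.netDisp_append, ih, netDisp_cons]
    obtain ⟨μ, b⟩ := l
    cases b <;> by_cases h : μ = κ <;> simp [netDisp, Letter.flip, h]

/-- Letter maps commute with reversal: permutations. [folklore] -/
theorem wordRev_map_permute {n : ℕ} (π : Equiv.Perm (Fin n)) (w : List (Letter n)) :
    wordRev (w.map (Letter.permute π)) = (wordRev w).map (Letter.permute π) := by
  simp only [wordRev, List.map_reverse, List.map_map]
  rfl

/-- Letter maps commute with reversal: reflections. [folklore] -/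
theorem wordRev_map_reflect {n : ℕ} (ρ : Fin n) (w : List (Letter n)) :
    wordRev (w.map (Letter.reflect ρ)) = (wordRev w).map (Letter.reflect ρ) := by
  simp only [wordRev, List.map_reverse, List.map_map]
  congr 2
  funext l
  obtain ⟨μ, b⟩ := l
  by_cases h : μ = ρ <;> simp [Letter.flip, Letter.reflect, h]

/-- The RUN of `|k|` letters `sign(k)·e_μ` ("take |n_{π(1)}| bonds in the direction sign n_{π(1)} e_{π(1)}", [Balaban1987RG1] p. 252). [cite: Balaban1987RG1, (0.3) p.252] -/
def axisRun {d : ℕ} (μ : Fin d) (k : ℤ) : List (Letter d) := List.replicate k.natAbs (μ, decide (0 ≤ k))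

/-- The STAIRCASE WORD through a list of axes: the runs of the listed axes in order. [cite: Balaban1987RG1, (0.3) p.252] -/
def stairRuns {d : ℕ} (n : Fin d → ℤ) : List (Fin d) → List (Letter d)
  | [] => []
  | a :: as => axisRun a (n a) ++ stairRuns n as

/-- **THE SHORTEST STAIRCASE CONTOUR `Γ ∈ G(y, x)` OF [Balaban1987RG1] (0.3) p. 252** determined by an ordering `σ` of the axes,
as a word: "If x − y = Σ_{μ=1}^d δ n_μ e_μ (δ is a lattice spacing, n_μ an integer such that |n_μ| ≦ L−1/2), then we construct
contours of G(y,x) in the following way: take a permutation {π(1), π(2), …} of indices μ with nonzero numbers n_μ, next take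
|n_{π(1)}| bonds in the direction sign n_{π(1)} e_{π(1)} starting at y, |n_{π(2)}| bonds in the direction sign n_{π(2)} e_{π(2)}
starting at y + δ n_{π(1)} e_{π(1)}, and so on. We define G(y,x) as the family of contours generated by all such permuations."
We index by ALL orderings `σ` of the `d` axes (axes with `n_μ = 0` contribute empty runs): each contour of `G(y,x)` then
occurs the same number `d!/|G(y,x)|` of times, so the uniform weight over orderings is the printed weight `1/|G(y,x)|`. [cite: Balaban1987RG1, (0.3) p.252] -/
def stairWord {d : ℕ} (σ : Equiv.Perm (Fin d)) (n : Fin d → ℤ) : List (Letter d) :=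
  stairRuns n ((List.finRange d).map σ)

/-- **THE LOOP WORD `Γ ∪ [x, x′] ∪ (−Γ′) ∪ (−c)` OF [Balaban1987RG1] (0.4) p. 253** at the coarse bond `c = ⟨y, y + e_μ⟩`, for the
offset `n` (`x = emb y + n`, `x′ = x + L e_μ`) and the orderings `σ, σ′` of `Γ ∈ G(c₋, x)`, `Γ′ ∈ G(c₊, x′)`: the staircase `Γ`,
the transported bond `[x, x′]` ("a contour which is obtained by a parallel transport of c to the point x", p. 252: `L` steps
`+e_μ`), the staircase `Γ′` backwards, and the straight line of `c` backwards (`−c`; the coarse bond variable `U(c)` of the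
fine configuration is the transport along the straight line from `emb c₋` to `emb c₊`, tree `AveragingRT.axialAvg`). [cite: Balaban1987RG1, (0.4) p.253] -/
def loopWord {d : ℕ} (L : ℕ) (μ : Fin d) (n : Fin d → ℤ) (σ σ' : Equiv.Perm (Fin d)) : List (Letter d) :=
  stairWord σ n ++ (List.replicate L (μ, true) ++ (wordRev (stairWord σ' n) ++ List.replicate L (μ, false)))

section WordLemmas

variable {d : ℕ}

/-- A run of `|k|` letters `sign(k)·e_μ` has net displacement `k e_μ`. [folklore] -/
theorem netDisp_axisRun (μ : Fin d) (k : ℤ) (κ : Fin d) : netDisp (axisRun μ k) κ = if μ = κ then k else 0 := by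
  rw [axisRun, T4ReflectionCone.netDisp_replicate]
  by_cases h : μ = κ
  · simp only [h, if_true]
    rcases le_or_gt 0 k with hk | hk
    · simp [hk, Int.natAbs_of_nonneg hk]
    · simp [not_le.mpr hk, Int.ofNat_natAbs_of_nonpos hk.le]
  · simp [h]

/-- The net displacement of the staircase through a duplicate-free list of axes. [folklore] -/
theorem netDisp_stairRuns (n : Fin d → ℤ) : ∀ (as : List (Fin d)), as.Nodup → ∀ κ : Fin d,
    netDisp (stairRuns n as) κ = if κ ∈ as then n κ else 0
  | [], _, κ => by simp [stairRuns, netDisp]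
  | a :: as, h, κ => by
    rw [List.nodup_cons] at h
    rw [stairRuns, T4ReflectionCone.netDisp_append, netDisp_axisRun, netDisp_stairRuns n as h.2 κ]
    by_cases hκ : a = κ
    · subst hκ
      simp [h.1]
    · simp [hκ, Ne.symm hκ]

/-- The list of axes in the order `σ` has no duplicates. [folklore] -/
theorem nodup_finRange_map (σ : Equiv.Perm (Fin d)) : ((List.finRange d).map σ).Nodup :=
  (List.nodup_finRange d).map σ.injective

/-- Every axis occurs in the list of axes in the order `σ`. [folklore] -/
theorem mem_finRange_map (σ : Equiv.Perm (Fin d)) (κ : Fin d) : κ ∈ (List.finRange d).map σ :=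
  List.mem_map.mpr ⟨σ.symm κ, List.mem_finRange _, σ.apply_symm_apply κ⟩

/-- A staircase word from `y` to `y + n` has net displacement `n`. [folklore] -/
theorem netDisp_stairWord (σ : Equiv.Perm (Fin d)) (n : Fin d → ℤ) (κ : Fin d) : netDisp (stairWord σ n) κ = n κ := by
  rw [stairWord, netDisp_stairRuns n _ (nodup_finRange_map σ) κ, if_pos (mem_finRange_map σ κ)]

/-- The loop word is CLOSED. [folklore] -/
theorem netDisp_loopWord (L : ℕ) (μ : Fin d) (n : Fin d → ℤ) (σ σ' : Equiv.Perm (Fin d)) (κ : Fin d) :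
    netDisp (loopWord L μ n σ σ') κ = 0 := by
  simp only [loopWord, T4ReflectionCone.netDisp_append, netDisp_wordRev, netDisp_stairWord, T4ReflectionCone.netDisp_replicate]
  by_cases h : μ = κ <;> simp [h]

/-! #### permutations of the axes -/

/-- Permuting the axes of a run. [folklore] -/
theorem axisRun_map_permute (π : Equiv.Perm (Fin d)) (μ : Fin d) (k : ℤ) :
    (axisRun μ k).map (Letter.permute π) = axisRun (π μ) k := by
  simp [axisRun, List.map_replicate, Letter.permute]

/-- Permuting the axes of a staircase through a list of axes. [folklore] -/
theorem stairRuns_map_permute (π : Equiv.Perm (Fin d)) (n : Fin d → ℤ) : ∀ as : List (Fin d),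
    (stairRuns n as).map (Letter.permute π) = stairRuns (n ∘ π.symm) (as.map π)
  | [] => rfl
  | a :: as => by
    rw [stairRuns, List.map_append, axisRun_map_permute, stairRuns_map_permute π n as, List.map_cons, stairRuns]
    simp

/-- Permuting the axes of a staircase word: the staircase for the permuted offset and the conjugated ordering. [folklore] -/
theorem stairWord_map_permute (π : Equiv.Perm (Fin d)) (σ : Equiv.Perm (Fin d)) (n : Fin d → ℤ) :
    (stairWord σ n).map (Letter.permute π) = stairWord (σ.trans π) (n ∘ π.symm) := by
  rw [stairWord, stairRuns_map_permute, stairWord, List.map_map]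
  rfl

/-- Permuting the axes of a loop word. [folklore] -/
theorem loopWord_map_permute (π : Equiv.Perm (Fin d)) (L : ℕ) (μ : Fin d) (n : Fin d → ℤ) (σ σ' : Equiv.Perm (Fin d)) :
    (loopWord L μ n σ σ').map (Letter.permute π) = loopWord L (π μ) (n ∘ π.symm) (σ.trans π) (σ'.trans π) := by
  simp only [loopWord, List.map_append, stairWord_map_permute, ← wordRev_map_permute, List.map_replicate]
  rfl

/-! #### reflections of one axis -/

/-- The offset with the `ρ`-th component negated. [folklore] -/
def negAt (ρ : Fin d) (n : Fin d → ℤ) : Fin d → ℤ := Function.update n ρ (-n ρ)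

/-- The negated component. [folklore] -/
@[simp] theorem negAt_self (ρ : Fin d) (n : Fin d → ℤ) : negAt ρ n ρ = -n ρ := by simp [negAt]

/-- The other components are unchanged. [folklore] -/
theorem negAt_of_ne (ρ : Fin d) (n : Fin d → ℤ) {κ : Fin d} (h : κ ≠ ρ) : negAt ρ n κ = n κ := by simp [negAt, h]

/-- Negating a component twice. [folklore] -/
theorem negAt_negAt (ρ : Fin d) (n : Fin d → ℤ) : negAt ρ (negAt ρ n) = n := by
  funext κ
  by_cases h : κ = ρ
  · subst h; simp
  · simp [negAt_of_ne _ _ h]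

/-- Reflecting one axis of a run. [folklore] -/
theorem axisRun_map_reflect (ρ μ : Fin d) (k : ℤ) :
    (axisRun μ k).map (Letter.reflect ρ) = axisRun μ (if μ = ρ then -k else k) := by
  unfold axisRun
  rw [List.map_replicate]
  by_cases h : μ = ρ
  · rw [if_pos h, Int.natAbs_neg]
    rcases eq_or_ne k 0 with hk | hk
    · subst hk; rfl
    · congr 1
      show (μ, if μ = ρ then !decide (0 ≤ k) else decide (0 ≤ k)) = (μ, decide (0 ≤ -k))
      rw [if_pos h]
      by_cases hk0 : 0 ≤ k
      · rw [decide_eq_true hk0, decide_eq_false (show ¬ (0 ≤ -k) by omega)]; rfl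
      · rw [decide_eq_false hk0, decide_eq_true (show 0 ≤ -k by omega)]; rfl
  · rw [if_neg h]
    congr 1
    show (μ, if μ = ρ then !decide (0 ≤ k) else decide (0 ≤ k)) = (μ, decide (0 ≤ k))
    rw [if_neg h]

/-- Reflecting one axis of a staircase through a list of axes. [folklore] -/
theorem stairRuns_map_reflect (ρ : Fin d) (n : Fin d → ℤ) : ∀ as : List (Fin d),
    (stairRuns n as).map (Letter.reflect ρ) = stairRuns (negAt ρ n) as
  | [] => rfl
  | a :: as => by
    rw [stairRuns, List.map_append, axisRun_map_reflect, stairRuns_map_reflect ρ n as, stairRuns]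
    congr 2
    by_cases h : a = ρ
    · subst h; simp
    · simp [h, negAt_of_ne _ _ h]

/-- Reflecting one axis of a staircase word: the staircase (same ordering) for the reflected offset. [folklore] -/
theorem stairWord_map_reflect (ρ : Fin d) (σ : Equiv.Perm (Fin d)) (n : Fin d → ℤ) :
    (stairWord σ n).map (Letter.reflect ρ) = stairWord σ (negAt ρ n) := by
  rw [stairWord, stairRuns_map_reflect, stairWord]

/-- Reflecting a TRANSVERSE axis `ρ ≠ μ` of a loop word at a `μ`-bond: the loop word for the reflected offset. [folklore] -/
theorem loopWord_map_reflect_of_ne {ρ μ : Fin d} (h : μ ≠ ρ) (L : ℕ) (n : Fin d → ℤ) (σ σ' : Equiv.Perm (Fin d)) :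
    (loopWord L μ n σ σ').map (Letter.reflect ρ) = loopWord L μ (negAt ρ n) σ σ' := by
  simp only [loopWord, List.map_append, stairWord_map_reflect, ← wordRev_map_reflect, List.map_replicate, Letter.reflect,
    if_neg h]

/-- Reflecting the LONGITUDINAL axis `μ` of a loop word at a `μ`-bond: the staircases for the reflected offset joined by the
REVERSED straight segments. [folklore] -/
theorem loopWord_map_reflect_self (μ : Fin d) (L : ℕ) (n : Fin d → ℤ) (σ σ' : Equiv.Perm (Fin d)) :
    (loopWord L μ n σ σ').map (Letter.reflect μ) =
      stairWord σ (negAt μ n) ++ (List.replicate L (μ, false) ++ (wordRev (stairWord σ' (negAt μ n)) ++ List.replicate L (μ, true))) := by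
  simp only [loopWord, List.map_append, stairWord_map_reflect, ← wordRev_map_reflect, List.map_replicate, Letter.reflect,
    if_true, Bool.not_true, Bool.not_false]

/-! #### prefixes (for locality: every bond of the loop lies in `B(c₋) ∪ B(c₊)`) -/

/-- A prefix of a concatenation is a prefix of the first word or the first word followed by a prefix of the second. [folklore] -/
theorem take_append_cases {α : Type*} (u v : List α) (k : ℕ) :
    (u ++ v).take k = u.take k ∨ (u ++ v).take k = u ++ v.take (k - u.length) := by
  rw [List.take_append]
  rcases le_or_gt k u.length with hk | hk
  · left
    rw [Nat.sub_eq_zero_of_le hk, List.take_zero, List.append_nil]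
  · right
    rw [List.take_of_length_le hk.le]

/-- The empty word has no net displacement (also `T4Continuum.netDisp_nil` shape). [folklore] -/
@[simp] theorem netDisp_nil' (κ : Fin d) : netDisp ([] : List (Letter d)) κ = 0 := by simp [netDisp]

/-- Prefixes of a run of `+μ` / `−μ` letters. [folklore] -/
theorem netDisp_take_replicate (k t : ℕ) (l : Letter d) (κ : Fin d) :
    netDisp ((List.replicate t l).take k) κ = (min k t : ℕ) * (if l.1 = κ then (if l.2 then (1 : ℤ) else -1) else 0) := by
  rw [List.take_replicate, T4ReflectionCone.netDisp_replicate]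

/-- Prefixes of a staircase do not move along axes outside its list. [folklore] -/
theorem netDisp_take_stairRuns_of_not_mem (n : Fin d → ℤ) : ∀ (as : List (Fin d)) (κ : Fin d), κ ∉ as → ∀ k : ℕ,
    netDisp ((stairRuns n as).take k) κ = 0
  | [], κ, _, k => by simp [stairRuns]
  | a :: as, κ, h, k => by
    rw [List.mem_cons, not_or] at h
    rcases take_append_cases (axisRun a (n a)) (stairRuns n as) k with h1 | h1 <;> rw [stairRuns, h1]
    · rw [axisRun, netDisp_take_replicate]
      simp [Ne.symm h.1]
    · rw [T4ReflectionCone.netDisp_append, netDisp_axisRun, netDisp_take_stairRuns_of_not_mem n as κ h.2, if_neg (Ne.symm h.1), add_zero]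

/-- Every prefix of a run to `k e_μ` stays between `0` and `k` along `μ` and does not move transversally. [folklore] -/
theorem netDisp_take_axisRun (a : Fin d) (m : ℤ) (k : ℕ) (κ : Fin d) :
    min 0 (if a = κ then m else 0) ≤ netDisp ((axisRun a m).take k) κ ∧
      netDisp ((axisRun a m).take k) κ ≤ max 0 (if a = κ then m else 0) := by
  rw [axisRun, netDisp_take_replicate]
  have ht : (min k m.natAbs : ℕ) ≤ m.natAbs := min_le_right _ _
  by_cases hκ : a = κ
  · simp only [hκ, if_true, decide_eq_true_eq]
    by_cases h0 : 0 ≤ m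
    · rw [if_pos h0, mul_one]
      have h1 := Int.natAbs_of_nonneg h0
      constructor <;> omega
    · rw [if_neg h0, mul_neg_one]
      have h1 := Int.ofNat_natAbs_of_nonpos (le_of_not_ge h0)
      constructor <;> omega
  · simp [hκ]

/-- Every prefix of a staircase through a duplicate-free list of axes stays in the box spanned by `0` and `n`. [folklore] -/
theorem netDisp_take_stairRuns (n : Fin d → ℤ) : ∀ (as : List (Fin d)), as.Nodup → ∀ (κ : Fin d) (k : ℕ),
    min 0 (n κ) ≤ netDisp ((stairRuns n as).take k) κ ∧ netDisp ((stairRuns n as).take k) κ ≤ max 0 (n κ)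
  | [], _, κ, k => by simp [stairRuns]
  | a :: as, h, κ, k => by
    rw [List.nodup_cons] at h
    rcases take_append_cases (axisRun a (n a)) (stairRuns n as) k with h1 | h1 <;> rw [stairRuns, h1]
    · have := netDisp_take_axisRun a (n a) k κ
      by_cases hκ : a = κ
      · subst hκ
        simpa using this
      · simp only [if_neg hκ] at this
        constructor <;> omega
    · rw [T4ReflectionCone.netDisp_append, netDisp_axisRun]
      by_cases hκ : a = κ
      · subst hκ
        rw [if_pos rfl, netDisp_take_stairRuns_of_not_mem n as a h.1, add_zero]
        constructor <;> omega
      · rw [if_neg hκ, zero_add]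
        exact netDisp_take_stairRuns n as h.2 κ _

/-- Every prefix of a staircase word to `n` stays in the coordinate box spanned by `0` and `n`. [folklore] -/
theorem netDisp_take_stairWord (σ : Equiv.Perm (Fin d)) (n : Fin d → ℤ) (κ : Fin d) (k : ℕ) :
    min 0 (n κ) ≤ netDisp ((stairWord σ n).take k) κ ∧ netDisp ((stairWord σ n).take k) κ ≤ max 0 (n κ) :=
  netDisp_take_stairRuns n _ (nodup_finRange_map σ) κ k

/-- Prefixes of the reverse word are complements of prefixes. [folklore] -/
theorem netDisp_take_wordRev (w : List (Letter d)) (k : ℕ) :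
    ∃ m, ∀ κ, netDisp ((wordRev w).take k) κ = netDisp (w.take m) κ - netDisp w κ := by
  refine ⟨w.length - k, fun κ => ?_⟩
  have h1 : (wordRev w).take k = wordRev (w.drop (w.length - k)) := by
    rw [wordRev, wordRev, List.take_reverse, List.length_map, ← List.map_drop]
  have h2 : netDisp w κ = netDisp (w.take (w.length - k)) κ + netDisp (w.drop (w.length - k)) κ := by
    rw [← T4ReflectionCone.netDisp_append, List.take_append_drop]
  rw [h1, netDisp_wordRev, h2]
  ring

/-- **Every prefix of the loop word `Γ ∪ [x,x′] ∪ (−Γ′) ∪ (−c)` (offsets `|n_ν| ≤ h`, `L = 2h+1`) has transverse displacement in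
`[-h, h]` and longitudinal displacement in `[-h, L + h]`** — so the loop stays in `B(c₋) ∪ B(c₊)`. [folklore] -/
theorem netDisp_take_loopWord {L h : ℕ} (μ : Fin d) (n : Fin d → ℤ) (hn : ∀ κ, -(h : ℤ) ≤ n κ ∧ n κ ≤ h)
    (σ σ' : Equiv.Perm (Fin d)) (k : ℕ) (κ : Fin d) :
    -(h : ℤ) ≤ netDisp ((loopWord L μ n σ σ').take k) κ ∧
      netDisp ((loopWord L μ n σ σ').take k) κ ≤ (if μ = κ then (L : ℤ) else 0) + h := by
  have hS := netDisp_take_stairWord σ n κ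
  have hS' := netDisp_take_stairWord σ' n κ
  have hnκ := hn κ
  unfold loopWord
  rcases take_append_cases (stairWord σ n)
    (List.replicate L (μ, true) ++ (wordRev (stairWord σ' n) ++ List.replicate L (μ, false))) k with h1 | h1 <;> rw [h1]
  · have := hS k
    by_cases hμ : μ = κ
    · rw [if_pos hμ]; constructor <;> omega
    · rw [if_neg hμ]; constructor <;> omega
  rw [T4ReflectionCone.netDisp_append, netDisp_stairWord]
  rcases take_append_cases (List.replicate L (μ, true)) (wordRev (stairWord σ' n) ++ List.replicate L (μ, false))
    (k - (stairWord σ n).length) with h2 | h2 <;> rw [h2]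
  · rw [netDisp_take_replicate]
    have ht : (min (k - (stairWord σ n).length) L : ℕ) ≤ L := min_le_right _ _
    by_cases hμ : μ = κ
    · simp only [hμ, if_true, mul_one]
      constructor <;> omega
    · simp only [if_neg hμ, mul_zero, add_zero]
      constructor <;> omega
  rw [T4ReflectionCone.netDisp_append, T4ReflectionCone.netDisp_replicate, List.length_replicate]
  rcases take_append_cases (wordRev (stairWord σ' n)) (List.replicate L (μ, false))
    (k - (stairWord σ n).length - L) with h3 | h3 <;> rw [h3]
  · obtain ⟨m, hm⟩ := netDisp_take_wordRev (stairWord σ' n) (k - (stairWord σ n).length - L)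
    rw [hm κ, netDisp_stairWord]
    have := hS' m
    by_cases hμ : μ = κ
    · simp only [hμ, if_true, mul_one]
      constructor <;> omega
    · simp only [if_neg hμ, mul_zero]
      constructor <;> omega
  rw [T4ReflectionCone.netDisp_append, netDisp_wordRev, netDisp_stairWord, netDisp_take_replicate]
  have ht : (min (k - (stairWord σ n).length - L - (wordRev (stairWord σ' n)).length) L : ℕ) ≤ L := min_le_right _ _
  by_cases hμ : μ = κ
  · simp only [hμ, if_true, mul_one, Bool.false_eq_true, if_false, mul_neg_one]
    constructor <;> omega
  · simp only [if_neg hμ, mul_zero]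
    constructor <;> omega

end WordLemmas

/-! ## 2. Walks: concatenation, reversal, symmetric images, bond sources; the straight line as a walk -/

section WalkLemmas2

variable {P : Params} {j : ℕ}

/-- The walk of a concatenation. [folklore] -/
theorem walk_append : ∀ (x : Site P j) (w₁ w₂ : List (Letter P.d)),
    walk x (w₁ ++ w₂) = walk x w₁ ++ walk (walkEnd x w₁) w₂
  | _, [], _ => rfl
  | x, (μ, true) :: w₁, w₂ => by
    rw [List.cons_append]
    simp only [walk, walkEnd]
    rw [walk_append (x.shift μ) w₁ w₂, List.cons_append]
  | x, (μ, false) :: w₁, w₂ => by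
    rw [List.cons_append]
    simp only [walk, walkEnd]
    rw [walk_append (x.unshift μ) w₁ w₂, List.cons_append]

/-- The end of a concatenated walk. [folklore] -/
theorem walkEnd_append (x : Site P j) (w₁ w₂ : List (Letter P.d)) :
    walkEnd x (w₁ ++ w₂) = walkEnd (walkEnd x w₁) w₂ := by
  funext ν
  simp only [walkEnd_apply, T4ReflectionCone.netDisp_append, Int.cast_add, add_assoc]

/-- Walking back along the reverse word returns to the base. [folklore] -/
theorem walkEnd_walkEnd_wordRev (x : Site P j) (w : List (Letter P.d)) : walkEnd (walkEnd x w) (wordRev w) = x := by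
  funext ν
  rw [walkEnd_apply, walkEnd_apply, netDisp_wordRev, Int.cast_neg, add_neg_cancel_right]

/-- THE SOURCE OF EVERY BOND OF A WALK IS THE END OF A PREFIX. [folklore] -/
theorem exists_src_eq_walkEnd_take : ∀ (x : Site P j) (w : List (Letter P.d)) (s : LStep P j), s ∈ walk x w →
    ∃ k, s.bond.src = walkEnd x (w.take k)
  | _, [], s, hs => by simp [walk] at hs
  | x, (μ, true) :: w, s, hs => by
    simp only [walk, List.mem_cons] at hs
    rcases hs with rfl | hs
    · exact ⟨0, rfl⟩
    · obtain ⟨k, hk⟩ := exists_src_eq_walkEnd_take (x.shift μ) w s hs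
      exact ⟨k + 1, by rw [List.take_succ_cons]; exact hk⟩
  | x, (μ, false) :: w, s, hs => by
    simp only [walk, List.mem_cons] at hs
    rcases hs with rfl | hs
    · exact ⟨1, rfl⟩
    · obtain ⟨k, hk⟩ := exists_src_eq_walkEnd_take (x.unshift μ) w s hs
      exact ⟨k + 1, by rw [List.take_succ_cons]; exact hk⟩

variable {G : Type*} [GaugeGroup G]

/-- Holonomy is multiplicative under concatenation. [folklore] -/
theorem holAt_append (U : GaugeField P j G) (γ₁ γ₂ : List (LStep P j)) :
    holAt U (γ₁ ++ γ₂) = holAt U γ₁ * holAt U γ₂ := by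
  simp only [holAt, List.map_append, List.prod_append]

/-- `U(−Γ) = U(Γ)⁻¹`: the holonomy along the reverse walk (from the end of `Γ`) is the inverse. [folklore] -/
theorem holAt_walk_wordRev (U : GaugeField P j G) : ∀ (x : Site P j) (w : List (Letter P.d)),
    holAt U (walk (walkEnd x w) (wordRev w)) = (holAt U (walk x w))⁻¹
  | x, [] => by simp [walk, walkEnd, holAt_nil]
  | x, (μ, true) :: w => by
    have h1 : wordRev ((μ, true) :: w) = wordRev w ++ [(μ, false)] := by rw [wordRev_cons]; rfl
    rw [h1]
    simp only [walkEnd, walk]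
    rw [walk_append, holAt_append, holAt_walk_wordRev U (x.shift μ) w, walkEnd_walkEnd_wordRev]
    simp only [walk, holAt_cons, holAt_nil, Site.unshift_shift, Bool.false_eq_true, ↓reduceIte, mul_one, mul_inv_rev]
  | x, (μ, false) :: w => by
    have h1 : wordRev ((μ, false) :: w) = wordRev w ++ [(μ, true)] := by rw [wordRev_cons]; rfl
    rw [h1]
    simp only [walkEnd, walk]
    rw [walk_append, holAt_append, holAt_walk_wordRev U (x.unshift μ) w, walkEnd_walkEnd_wordRev]
    simp only [walk, holAt_cons, holAt_nil, Bool.false_eq_true, ↓reduceIte, mul_one, mul_inv_rev, inv_inv]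

/-- HOLONOMIES IN THE CENTRE-REFLECTED CONFIGURATION: `𝒰(walk_x w)(c_ρ U) = 𝒰(walk_{c_ρ x}(r_ρ w))(U)` (the walk of the reflected
word from the centre-reflected base `-x - e_ρ`). [folklore] -/
theorem holAt_creflect_walk (ρ : Fin P.d) (U : GaugeField P j G) (x : Site P j) (w : List (Letter P.d)) :
    holAt (U.creflect ρ) (walk x w) = holAt U (walk ((x.reflect ρ).unshift ρ) (w.map (Letter.reflect ρ))) := by
  rw [GaugeField.creflect_eq, holAt_reflect, ← walk_reflect, holAt_translate, ← walk_translate, Site.add_zero_unshift]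

/-! #### block centres under the symmetries; the straight line of a coarse bond as a walk -/

/-- Block centres commute with coordinate permutations. [folklore] -/
theorem emb_permute (π : Equiv.Perm (Fin P.d)) (y : Site P (j+1)) : emb (y.permute π) = (emb y).permute π := rfl

/-- `emb (y + e_μ) = emb y + L e_μ` in coordinates. [folklore] -/
theorem emb_shift_apply (y : Site P (j+1)) (μ ν : Fin P.d) :
    emb (y.shift μ) ν = emb y ν + (if ν = μ then (P.L : ZMod (P.sitesPerDir j)) else 0) := by
  rw [← Site.add_zero_shift, Site.emb_add, Site.add_apply, Site.scale_apply, Site.shift_apply]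
  by_cases h : ν = μ
  · rw [if_pos h, if_pos h, Site.zero_apply, zero_add, Site.scaleCoord_one]
  · rw [if_neg h, if_neg h, Site.zero_apply, map_zero]

/-- The straight walk of `t` steps `+e_μ` from the centre of `B(c₋)` ends at the `t`-th line site of `AveragingRT`. [folklore] -/
theorem walkEnd_replicate_line (c : PBond P (j+1)) (t : ℕ) :
    walkEnd (emb c.src) (List.replicate t (c.dir, true)) = AveragingRT.lineSite c t := by
  funext ν
  rw [walkEnd_apply, T4ReflectionCone.netDisp_replicate, AveragingRT.lineSite]
  by_cases h : ν = c.dir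
  · subst h
    simp
  · rw [Function.update_of_ne h]
    simp [Ne.symm h]

/-- The partial transports of `AveragingRT.pathProd` are holonomies of straight walks. [folklore] -/
theorem pathProd_eq_holAt_walk (U : GaugeField P j G) (c : PBond P (j+1)) : ∀ n : ℕ,
    AveragingRT.pathProd U c n = holAt U (walk (emb c.src) (List.replicate n (c.dir, true)))
  | 0 => by simp [AveragingRT.pathProd, walk, holAt_nil]
  | n + 1 => by
    rw [AveragingRT.pathProd, pathProd_eq_holAt_walk U c n, List.replicate_succ', walk_append, holAt_append,
      walkEnd_replicate_line]
    simp [walk, holAt_cons, holAt_nil, AveragingRT.line]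

/-- **THE COARSE BOND VARIABLE `U(c)` OF (0.4) IS THE HOLONOMY OF THE STRAIGHT WALK** of `L` steps from `emb c₋` to `emb c₊`
(tree `AveragingRT.axialAvg`, [Balaban1984PropagatorsI] (1.7)); its reverse is the segment `(−c)` of the loop word. [folklore] -/
theorem axialAvg_eq_holAt_walk (U : GaugeField P j G) (c : PBond P (j+1)) :
    AveragingRT.axialAvg U c = holAt U (walk (emb c.src) (List.replicate P.L (c.dir, true))) :=
  pathProd_eq_holAt_walk U c P.L

/-- The axial averaging commutes with coordinate permutations: `axialAvg (U ∘ π) c = axialAvg U (π c)`. [folklore] -/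
theorem axialAvg_permute (π : Equiv.Perm (Fin P.d)) (U : GaugeField P j G) (c : PBond P (j+1)) :
    AveragingRT.axialAvg (U.permute π) c = AveragingRT.axialAvg U (c.permute π) := by
  rw [axialAvg_eq_holAt_walk, axialAvg_eq_holAt_walk, holAt_permute, ← walk_permute, List.map_replicate]
  rfl

/-! #### block membership from centred coordinates -/

/-- A fine site whose coordinates are those of the centre `emb y` displaced by at most `(L-1)/2` lies in `B(y)` (standing range). [folklore] -/
theorem blockOf_eq_of_near_emb (hj : j + 1 ≤ P.m + P.K) (y : Site P (j+1)) (s : Site P j) (e : Fin P.d → ℤ)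
    (hs : ∀ ν, s ν = emb y ν + ((e ν : ℤ) : ZMod (P.sitesPerDir j)))
    (he : ∀ ν, -(((P.L - 1) / 2 : ℕ) : ℤ) ≤ e ν ∧ e ν ≤ (((P.L - 1) / 2 : ℕ) : ℤ)) : blockOf s = y := by
  have hL := AveragingRT.two_mul_half_add_one P
  set h : ℕ := (P.L - 1) / 2 with hh
  let r : Fin P.d → Fin P.L := fun ν => ⟨((h : ℤ) + e ν).toNat, by have := he ν; omega⟩
  have key : s = Site.blockSite y r := by
    funext ν
    have h0 : 0 ≤ (h : ℤ) + e ν := by have := he ν; omega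
    rw [hs ν]
    show (((y ν).val * P.L + (P.L - 1) / 2 : ℕ) : ZMod (P.sitesPerDir j)) + ((e ν : ℤ) : ZMod (P.sitesPerDir j)) =
      (((y ν).val * P.L + ((h : ℤ) + e ν).toNat : ℕ) : ZMod (P.sitesPerDir j))
    rw [← hh, ← Int.cast_natCast (R := ZMod (P.sitesPerDir j)) ((y ν).val * P.L + h), ← Int.cast_add,
      ← Int.cast_natCast (R := ZMod (P.sitesPerDir j)) ((y ν).val * P.L + ((h : ℤ) + e ν).toNat)]
    congr 1
    push_cast
    rw [Int.toNat_of_nonneg h0]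
    ring
  rw [key, Site.blockOf_blockSite hj]

/-- `emb y + L e_μ = emb (y + e_μ)`: the straight walk of `L` steps from a block centre ends at the next block centre (no range
hypothesis: `Site.emb_add`). [folklore] -/
theorem walkEnd_replicate_L (y : Site P (j+1)) (μ : Fin P.d) :
    walkEnd (emb y) (List.replicate P.L (μ, true)) = emb (y.shift μ) := by
  funext ν
  rw [walkEnd_apply, T4ReflectionCone.netDisp_replicate, emb_shift_apply]
  by_cases h : ν = μ
  · subst h; simp
  · simp [h, Ne.symm h]

/-- The reverse word is an involution. [folklore] -/
theorem wordRev_wordRev {n : ℕ} (w : List (Letter n)) : wordRev (wordRev w) = w := by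
  simp only [wordRev, List.map_reverse, List.reverse_reverse, List.map_map]
  conv_rhs => rw [← List.map_id w]
  congr 1
  funext l
  simp [Letter.flip]

end WalkLemmas2

end T4Continuum

/-! ## 3. The (0.4)-shaped block averaging `blockAvg ℰ` as a total `Averaging`, for an arbitrary small-loop average `ℰ` -/

namespace BlockAveraging

open T4Continuum AveragingRT

variable {P : Params} {j : ℕ} {G : Type*} [GaugeGroup G]

/-- **THE INDEX SET OF THE DOUBLE AVERAGE IN (0.4)** at a coarse bond `c`: the point `x ∈ B(c₋)` through its offset
`r ∈ {0,…,L-1}^d` from the lowest label of the block (tree `Site.blockSite c₋ r`; `n_ν = r_ν - (L-1)/2` is the printed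
`x - y = Σ δ n_μ e_μ`, `|n_μ| ≤ (L-1)/2`), and two orderings `σ, σ′` of ALL `d` indices generating `Γ ∈ G(c₋, x)`,
`Γ′ ∈ G(c₊, x′)` (the printed "permutation {π(1), π(2), …} of indices μ with nonzero numbers n_μ", p. 252, is the induced
order of the nonzero ones; zero runs are empty).  For each `x` every contour of `G(c₋,x)` arises from exactly `d!/|G(c₋,x)|`
orderings, so the uniform weight on this finite set induces the printed weights `L^{-d} |G(c₋,x)|⁻¹ |G(c₊,x′)|⁻¹` on the
distinct loops. [cite: Balaban1987RG1, (0.4) p.253] -/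
abbrev Idx (P : Params) : Type := (Fin P.d → Fin P.L) × Equiv.Perm (Fin P.d) × Equiv.Perm (Fin P.d)

/-- The index set is nonempty (`L ≥ 1`). [folklore] -/
instance instNonemptyIdx (P : Params) : Nonempty (Idx P) := ⟨(fun _ => ⟨0, P.L_pos⟩, 1, 1)⟩

/-- The centred offset `n = r - (L-1)/2` of [Balaban1987RG1] p. 252. [cite: Balaban1987RG1, (0.3) p.252] -/
def off (r : Fin P.d → Fin P.L) : Fin P.d → ℤ := fun ν => ((r ν : ℕ) : ℤ) - (((P.L - 1) / 2 : ℕ) : ℤ)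

/-- `|n_ν| ≤ (L-1)/2`. [cite: Balaban1987RG1, (0.3) p.252] -/
theorem off_bounds (r : Fin P.d → Fin P.L) (ν : Fin P.d) :
    -(((P.L - 1) / 2 : ℕ) : ℤ) ≤ off r ν ∧ off r ν ≤ (((P.L - 1) / 2 : ℕ) : ℤ) := by
  have hL := two_mul_half_add_one P
  have hr := (r ν).isLt
  simp only [off]
  constructor <;> omega

/-- **THE LOOP VARIABLES `U(Γ ∪ [x,x′] ∪ (−Γ′) ∪ (−c))` OF [Balaban1987RG1] (0.4) p. 253**, for `x ∈ B(c₋)`, `Γ ∈ G(c₋,x)`,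
`Γ′ ∈ G(c₊,x′)` (index `i = (r, σ, σ′)`): the holonomy (tree `T4Continuum.holAt`/`walk`) of the fine configuration along the
closed loop word from the block centre `emb c₋`. [cite: Balaban1987RG1, (0.4) p.253] -/
def loopHol (U : GaugeField P j G) (c : PBond P (j+1)) (i : Idx P) : G :=
  holAt U (walk (emb c.src) (loopWord P.L c.dir (off i.1) i.2.1 i.2.2))

variable (ℰ : LoopAverage G)

/-- THE SMALL-FIELD CONDITION at `c`: every loop variable of (0.4) at `c` is within `δ` of the identity — the domain on which
the printed `log` of (0.4) (and the axioms (0.5)–(0.7)) are meaningful ("for a set {U_j} of elements close to the identity of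
the group", p. 253).  Gauge INVARIANT (`small_gaugeAct_iff`). [cite: Balaban1987RG1, (0.4) p.253] -/
def Small (U : GaugeField P j G) (c : PBond P (j+1)) : Prop := ∀ i, dist1 (loopHol U c i) < ℰ.δ

open scoped Classical in
/-- THE CORRECTION FACTOR `exp[i Σ_x L^{-d} Σ_Γ |G|⁻¹ Σ_Γ′ |G|⁻¹ (1/i) log U(Γ ∪ [x,x′] ∪ (−Γ′) ∪ (−c))]` OF (0.4), axiomatised:
the small-loop average `ℰ` of the family of loop variables on small fields, and `1` (i.e. the axial averaging) off the
small-field domain — the TOTAL EXTENSION asked for by cell row T4-D.L ("a.e.-defined M(·) extended"); the extension is by a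
gauge-invariant guard, so the total map keeps covariance and all lattice symmetries exactly. [cite: Balaban1987RG1, (0.4) p.253] -/
def corr (U : GaugeField P j G) (c : PBond P (j+1)) : G :=
  if Small ℰ U c then ℰ.avg (loopHol U c) else 1

/-- **`Ū(c) = M(U, c) = exp[…] U(c)` OF [Balaban1987RG1] (0.4) p. 253 as a total map** `GaugeField P j G → GaugeField P (j+1) G`:
the correction factor times the coarse bond variable `U(c)` (the straight-line transporter `AveragingRT.axialAvg`, = the
holonomy of the segment `c` of the loop, `axialAvg_eq_holAt_walk`). [cite: Balaban1987RG1, (0.4) p.253] -/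
def avgFun (U : GaugeField P j G) : GaugeField P (j+1) G := fun c => corr ℰ U c * axialAvg U c

/-! ### gauge covariance (B7 (11) / `Setup.Averaging.covariant`) -/

/-- Loop variables based at `emb c₋` transform by conjugation with `u(emb c₋)` ([Balaban1985Averaging] (8), closed walk). [cite: Balaban1985Averaging, (8) p.18] -/
theorem loopHol_gaugeAct (u : GaugeTransf P j G) (U : GaugeField P j G) (c : PBond P (j+1)) (i : Idx P) :
    loopHol (GaugeField.gaugeAct u U) c i = u (emb c.src) * loopHol U c i * (u (emb c.src))⁻¹ := by
  unfold loopHol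
  rw [holAt_gaugeAct_walk, walkEnd_eq_self_of_netDisp]
  intro ν
  rw [netDisp_loopWord, Int.cast_zero]

/-- The small-field condition is gauge invariant (`dist1 (h g h⁻¹) = dist1 g`). [folklore] -/
theorem small_gaugeAct_iff (u : GaugeTransf P j G) (U : GaugeField P j G) (c : PBond P (j+1)) :
    Small ℰ (GaugeField.gaugeAct u U) c ↔ Small ℰ U c := by
  simp only [Small, loopHol_gaugeAct, GaugeGroup.dist1_conj]

/-- The correction factor transforms by conjugation with `u(emb c₋)` ((0.6) with `v = u⁻¹`). [cite: Balaban1987RG1, (0.6) p.253] -/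
theorem corr_gaugeAct (u : GaugeTransf P j G) (U : GaugeField P j G) (c : PBond P (j+1)) :
    corr ℰ (GaugeField.gaugeAct u U) c = u (emb c.src) * corr ℰ U c * (u (emb c.src))⁻¹ := by
  by_cases h : Small ℰ U c
  · have h' : Small ℰ (GaugeField.gaugeAct u U) c := (small_gaugeAct_iff ℰ u U c).mpr h
    unfold corr
    rw [if_pos h', if_pos h]
    have : loopHol (GaugeField.gaugeAct u U) c = fun i => u (emb c.src) * loopHol U c i * (u (emb c.src))⁻¹ :=
      funext (loopHol_gaugeAct u U c)
    rw [this, ℰ.avg_conj _ h]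
  · have h' : ¬ Small ℰ (GaugeField.gaugeAct u U) c := fun h'' => h ((small_gaugeAct_iff ℰ u U c).mp h'')
    unfold corr
    rw [if_neg h', if_neg h]
    group

/-- **COVARIANCE `Ū^u = (Ū)^u` ([Balaban1985Averaging] (11)) of the total block averaging**, in the standing range. [cite: Balaban1985Averaging, (11) p.19] -/
theorem avgFun_covariant (hj : j + 1 ≤ P.m + P.K) (u : GaugeTransf P j G) (U : GaugeField P j G) :
    avgFun ℰ (GaugeField.gaugeAct u U) = GaugeField.gaugeAct (fun y => u (emb y)) (avgFun ℰ U) := by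
  funext c
  show corr ℰ (GaugeField.gaugeAct u U) c * axialAvg (GaugeField.gaugeAct u U) c =
    u (emb c.src) * (corr ℰ U c * axialAvg U c) * (u (emb c.tgt))⁻¹
  rw [corr_gaugeAct, axialAvg_covariant hj]
  show _ * (u (emb c.src) * axialAvg U c * (u (emb c.tgt))⁻¹) = _
  group

/-! ### locality (`Setup.Averaging.local_dep`): every bond of every loop lies in `B(c₋) ∪ B(c₊)` -/

/-- Every bond of the loop `Γ ∪ [x,x′] ∪ (−Γ′) ∪ (−c)` issues from a site of `B(c₋) ∪ B(c₊)` (standing range; prefix box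
`netDisp_take_loopWord` + `blockOf_eq_of_near_emb`). [folklore] -/
theorem blockOf_src_of_mem_walk (hj : j + 1 ≤ P.m + P.K) (c : PBond P (j+1)) (i : Idx P) (s : LStep P j)
    (hs : s ∈ walk (emb c.src) (loopWord P.L c.dir (off i.1) i.2.1 i.2.2)) :
    blockOf s.bond.src = c.src ∨ blockOf s.bond.src = c.tgt := by
  obtain ⟨k, hk⟩ := exists_src_eq_walkEnd_take _ _ s hs
  have hL := two_mul_half_add_one P
  set e : Fin P.d → ℤ := fun κ => netDisp ((loopWord P.L c.dir (off i.1) i.2.1 i.2.2).take k) κ with he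
  have hb : ∀ κ, -(((P.L - 1) / 2 : ℕ) : ℤ) ≤ e κ ∧ e κ ≤ (if c.dir = κ then (P.L : ℤ) else 0) + (((P.L - 1) / 2 : ℕ) : ℤ) :=
    fun κ => netDisp_take_loopWord (L := P.L) (h := (P.L - 1) / 2) c.dir (off i.1) (off_bounds i.1) i.2.1 i.2.2 k κ
  by_cases hfar : e c.dir ≤ (((P.L - 1) / 2 : ℕ) : ℤ)
  · left
    refine blockOf_eq_of_near_emb hj c.src s.bond.src e (fun ν => by rw [hk, walkEnd_apply]) (fun ν => ⟨(hb ν).1, ?_⟩)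
    by_cases hν : c.dir = ν
    · rw [← hν]; exact hfar
    · have := (hb ν).2; rw [if_neg hν] at this; omega
  · right
    refine blockOf_eq_of_near_emb hj c.tgt s.bond.src (fun κ => e κ - (if κ = c.dir then (P.L : ℤ) else 0)) ?_ ?_
    · intro ν
      rw [hk, walkEnd_apply, PBond.tgt, emb_shift_apply]
      by_cases hν : ν = c.dir
      · rw [if_pos hν, if_pos hν]; push_cast; ring
      · rw [if_neg hν, if_neg hν, add_zero, sub_zero]
    · intro ν
      by_cases hν : ν = c.dir
      · subst hν
        have := (hb c.dir).2
        rw [if_pos rfl] at this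
        rw [if_pos rfl]
        constructor <;> omega
      · rw [if_neg hν, sub_zero]
        refine ⟨(hb ν).1, ?_⟩
        have := (hb ν).2
        rw [if_neg (Ne.symm hν)] at this
        omega

/-- The loop variables at `c` depend only on `U` on bonds issuing from `B(c₋) ∪ B(c₊)`. [folklore] -/
theorem loopHol_local (hj : j + 1 ≤ P.m + P.K) (U U' : GaugeField P j G) (c : PBond P (j+1))
    (hUU' : ∀ b : PBond P j, (blockOf b.src = c.src ∨ blockOf b.src = c.tgt) → U b = U' b) :
    loopHol U c = loopHol U' c :=
  funext fun i => T4ReflectionCone.holAt_congr fun s hs => hUU' s.bond (blockOf_src_of_mem_walk hj c i s hs)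

/-- **LOCALITY of the total block averaging**, in the standing range. [cite: Balaban1985Averaging, p.19] -/
theorem avgFun_local (hj : j + 1 ≤ P.m + P.K) (U U' : GaugeField P j G) (c : PBond P (j+1))
    (hUU' : ∀ b : PBond P j, (blockOf b.src = c.src ∨ blockOf b.src = c.tgt) → U b = U' b) :
    avgFun ℰ U c = avgFun ℰ U' c := by
  have hc : corr ℰ U c = corr ℰ U' c := by
    unfold corr Small
    rw [loopHol_local hj U U' c hUU']
  show corr ℰ U c * axialAvg U c = corr ℰ U' c * axialAvg U' c
  rw [hc, axialAvg_local hj U U' c hUU']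

/-- **BAŁABAN'S SYMMETRIC BLOCK AVERAGING [Balaban1987RG1] (0.4) AS AN INHABITANT OF `Setup.Averaging`** (total in `j` and in
`U`; covariance and locality supplied in the standing range, as the structure asks).  `blockAvg (LoopAverage.trivial G)` is
the axial averaging of `AveragingRT` (`avgFun_trivial`). [cite: Balaban1987RG1, (0.4) p.253] -/
def blockAvg : Averaging P j G where
  avg := avgFun ℰ
  covariant := fun hj u U => avgFun_covariant ℰ hj u U
  local_dep := fun hj U U' c h => avgFun_local ℰ hj U U' c h

/-- `(blockAvg ℰ).avg = avgFun ℰ`. [folklore] -/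
@[simp] theorem blockAvg_avg : (blockAvg (P := P) (j := j) ℰ).avg = avgFun ℰ := rfl

/-- With the trivial small-loop average the block averaging IS the axial averaging. [folklore] -/
theorem avgFun_trivial (U : GaugeField P j G) : avgFun (LoopAverage.trivial G) U = axialAvg U := by
  funext c
  simp [avgFun, corr, LoopAverage.avg, LoopAverage.trivial]

/-! ## 4. Lattice symmetries of the total block averaging ("symmetric with respect to lattice Euclidean transformations", p. 252) -/

/-! ### coordinate permutations (`T4Continuum.FiniteEpsData.AvgPermEquivariant`) -/

/-- The index bijection induced by a coordinate permutation. [folklore] -/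
def idxPerm (π : Equiv.Perm (Fin P.d)) : Idx P ≃ Idx P where
  toFun i := (i.1 ∘ π.symm, i.2.1.trans π, i.2.2.trans π)
  invFun i := (i.1 ∘ π, i.2.1.trans π.symm, i.2.2.trans π.symm)
  left_inv i := by
    obtain ⟨r, σ, σ'⟩ := i
    refine Prod.ext ?_ (Prod.ext ?_ ?_)
    · funext ν; simp
    · ext x; simp
    · ext x; simp
  right_inv i := by
    obtain ⟨r, σ, σ'⟩ := i
    refine Prod.ext ?_ (Prod.ext ?_ ?_)
    · funext ν; simp
    · ext x; simp
    · ext x; simp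

/-- Loop variables of the pulled-back configuration `U ∘ π` at `c` are the loop variables of `U` at `π c`, reindexed. [folklore] -/
theorem loopHol_permute (π : Equiv.Perm (Fin P.d)) (U : GaugeField P j G) (c : PBond P (j+1)) (i : Idx P) :
    loopHol (U.permute π) c i = loopHol U (c.permute π) (idxPerm π i) := by
  unfold loopHol
  rw [holAt_permute, ← walk_permute, loopWord_map_permute]
  rfl

/-- The small-field condition is transported by coordinate permutations. [folklore] -/
theorem small_permute_iff (π : Equiv.Perm (Fin P.d)) (U : GaugeField P j G) (c : PBond P (j+1)) :
    Small ℰ (U.permute π) c ↔ Small ℰ U (c.permute π) := by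
  simp only [Small, loopHol_permute]
  exact ⟨fun h i => by simpa using h ((idxPerm π).symm i), fun h i => h _⟩

/-- The correction factor is transported by coordinate permutations ((0.7) as reindexing invariance). [cite: Balaban1987RG1, (0.7) p.253] -/
theorem corr_permute (π : Equiv.Perm (Fin P.d)) (U : GaugeField P j G) (c : PBond P (j+1)) :
    corr ℰ (U.permute π) c = corr ℰ U (c.permute π) := by
  by_cases h : Small ℰ U (c.permute π)
  · have h' := (small_permute_iff ℰ π U c).mpr h
    unfold corr
    rw [if_pos h', if_pos h]
    have : loopHol (U.permute π) c = loopHol U (c.permute π) ∘ idxPerm π := funext (loopHol_permute π U c)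
    rw [this, ℰ.avg_reindex _ h]
  · have h' : ¬ Small ℰ (U.permute π) c := fun h'' => h ((small_permute_iff ℰ π U c).mp h'')
    unfold corr
    rw [if_neg h', if_neg h]

/-- **THE TOTAL BLOCK AVERAGING COMMUTES WITH COORDINATE PERMUTATIONS**: `avg (U ∘ π) = (avg U) ∘ π` (the shape
`AvgPermEquivariant` of `T4Continuum`, at one level). [cite: Balaban1987RG1, (2.17) p.269] -/
theorem avgFun_permute (π : Equiv.Perm (Fin P.d)) (U : GaugeField P j G) :
    avgFun ℰ (U.permute π) = (avgFun ℰ U).permute π := by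
  funext c
  show corr ℰ (U.permute π) c * axialAvg (U.permute π) c = corr ℰ U (c.permute π) * axialAvg U (c.permute π)
  rw [corr_permute, axialAvg_permute]

/-! ### translations (`T4Covariance`'s `AvgTranslEquivariant`) -/

/-- Loop variables of `U ∘ τ_{L a}` at `c` are the loop variables of `U` at `c + a` (`Site.emb_add`). [folklore] -/
theorem loopHol_translate (a : Site P (j+1)) (U : GaugeField P j G) (c : PBond P (j+1)) (i : Idx P) :
    loopHol (U.translate (Site.scale a)) c i = loopHol U (c.translate a) i := by
  unfold loopHol
  rw [holAt_translate, ← walk_translate, ← Site.emb_add]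
  rfl

/-- **THE TOTAL BLOCK AVERAGING INTERTWINES THE TRANSLATIONS**: `avg (U ∘ τ_{L a}) = (avg U) ∘ τ_a`. [cite: Balaban1987RG1, (2.17) p.269] -/
theorem avgFun_translate (a : Site P (j+1)) (U : GaugeField P j G) :
    avgFun ℰ (U.translate (Site.scale a)) = (avgFun ℰ U).translate a := by
  funext c
  have hl : loopHol (U.translate (Site.scale a)) c = loopHol U (c.translate a) := funext (loopHol_translate a U c)
  have hc : corr ℰ (U.translate (Site.scale a)) c = corr ℰ U (c.translate a) := by
    unfold corr Small
    rw [hl]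
  rw [GaugeField.translate_apply]
  show corr ℰ _ c * axialAvg _ c = corr ℰ U (c.translate a) * axialAvg U (c.translate a)
  rw [hc, axialAvg_translate, GaugeField.translate_apply]

/-! ### centre reflections (`T4Covariance`'s `AvgReflEquivariant`, `GaugeField.creflect`) -/

/-- Reflecting the `ρ`-th offset inside `{0,…,L-1}`: `r_ρ ↦ L - 1 - r_ρ` (`Fin.rev`), i.e. `n_ρ ↦ -n_ρ`. [folklore] -/
def revAt (ρ : Fin P.d) (r : Fin P.d → Fin P.L) : Fin P.d → Fin P.L := Function.update r ρ (Fin.rev (r ρ))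

/-- `revAt ρ` is an involution. [folklore] -/
theorem revAt_revAt (ρ : Fin P.d) (r : Fin P.d → Fin P.L) : revAt ρ (revAt ρ r) = r := by
  funext ν
  by_cases h : ν = ρ
  · subst h; simp [revAt]
  · simp [revAt, h]

/-- Reflecting the `ρ`-th offset negates the `ρ`-th centred offset: `off (revAt ρ r) = negAt ρ (off r)`. [folklore] -/
theorem off_revAt (ρ : Fin P.d) (r : Fin P.d → Fin P.L) : off (revAt ρ r) = negAt ρ (off r) := by
  have hL := two_mul_half_add_one P
  funext ν
  by_cases h : ν = ρ
  · subst h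
    have hr := (r ν).isLt
    simp only [off, revAt, negAt, Function.update_self, Fin.val_rev]
    omega
  · simp [off, revAt, negAt, h]

/-- The index bijection induced by a transverse reflection. [folklore] -/
def idxRefl (ρ : Fin P.d) : Idx P ≃ Idx P where
  toFun i := (revAt ρ i.1, i.2.1, i.2.2)
  invFun i := (revAt ρ i.1, i.2.1, i.2.2)
  left_inv i := by obtain ⟨r, σ, σ'⟩ := i; simp [revAt_revAt]
  right_inv i := by obtain ⟨r, σ, σ'⟩ := i; simp [revAt_revAt]

/-- The index bijection induced by the longitudinal reflection (the roles of `Γ` and `Γ′` are exchanged). [folklore] -/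
def idxReflSwap (ρ : Fin P.d) : Idx P ≃ Idx P where
  toFun i := (revAt ρ i.1, i.2.2, i.2.1)
  invFun i := (revAt ρ i.1, i.2.2, i.2.1)
  left_inv i := by obtain ⟨r, σ, σ'⟩ := i; simp [revAt_revAt]
  right_inv i := by obtain ⟨r, σ, σ'⟩ := i; simp [revAt_revAt]

/-- TRANSVERSE reflection (`c.dir ≠ ρ`): the loop variables of `c_ρ U` at `c` are those of `U` at the reflected bond, reindexed. [folklore] -/
theorem loopHol_creflect_of_ne (ρ : Fin P.d) (U : GaugeField P j G) (c : PBond P (j+1)) (h : c.dir ≠ ρ) (i : Idx P) :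
    loopHol (U.creflect ρ) c i = loopHol U (crefBond ρ c) (idxRefl ρ i) := by
  unfold loopHol
  rw [holAt_creflect_walk, loopWord_map_reflect_of_ne h, ← Site.emb_creflect, ← crefBond_src_of_ne ρ c h, ← off_revAt]
  rfl

/-- LONGITUDINAL reflection (`c.dir = ρ`): the loop of `c_ρ U` at `c` is, read in `U`, the loop at the reflected bond `c′` with
`Γ, Γ′` exchanged, traversed BACKWARDS and re-based at the other block centre: its variable is `U(c′)⁻¹ W⁻¹ U(c′)`. [folklore] -/
theorem loopHol_creflect_of_eq (ρ : Fin P.d) (U : GaugeField P j G) (c : PBond P (j+1)) (h : c.dir = ρ) (i : Idx P) :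
    loopHol (U.creflect ρ) c i =
      (axialAvg U (crefBond ρ c))⁻¹ * (loopHol U (crefBond ρ c) (idxReflSwap ρ i))⁻¹ * axialAvg U (crefBond ρ c) := by
  subst h
  obtain ⟨r, σ, σ'⟩ := i
  set c' := crefBond c.dir c with hc'
  set x' : Site P j := emb c'.src with hx'
  set F : List (Letter P.d) := List.replicate P.L (c.dir, true) with hF
  set B : List (Letter P.d) := List.replicate P.L (c.dir, false) with hB
  set S : List (Letter P.d) := stairWord σ (off (revAt c.dir r)) with hS
  set S' : List (Letter P.d) := stairWord σ' (off (revAt c.dir r)) with hS'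
  set T : List (Letter P.d) := S ++ (B ++ wordRev S') with hT
  -- the loop word at `c'` with `Γ, Γ'` exchanged, and its reverse
  have hWdef : loopWord P.L c.dir (off (revAt c.dir r)) σ' σ = S' ++ (F ++ (wordRev S ++ B)) := rfl
  have hclosed : walkEnd x' (S' ++ (F ++ (wordRev S ++ B))) = x' :=
    walkEnd_eq_self_of_netDisp fun ν => by rw [← hWdef, netDisp_loopWord, Int.cast_zero]
  have hrev : wordRev (S' ++ (F ++ (wordRev S ++ B))) = F ++ T := by
    simp only [hT, wordRev_append, wordRev_wordRev, hF, hB, wordRev_replicate, List.append_assoc]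
    rfl
  have hA : axialAvg U c' = holAt U (walk x' F) := axialAvg_eq_holAt_walk U c'
  have hW : loopHol U c' (idxReflSwap c.dir (r, σ, σ')) = holAt U (walk x' (S' ++ (F ++ (wordRev S ++ B)))) := rfl
  -- the reflected loop of `c`, read in `U`: the word `T ++ F` from the far centre `walkEnd x' F`
  have hz : ((emb c.src).reflect c.dir).unshift c.dir = walkEnd x' F := by
    rw [← Site.emb_creflect, hF, walkEnd_replicate_L, hc', crefBond_src_of_eq _ _ rfl, Site.shift_unshift,
      Site.shift_reflect_self]
  have hL : loopHol (U.creflect c.dir) c (r, σ, σ') = holAt U (walk (walkEnd x' F) (T ++ F)) := by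
    unfold loopHol
    rw [holAt_creflect_walk, loopWord_map_reflect_self, ← off_revAt, hz]
    simp only [hT, hF, hB, hS, hS', List.append_assoc]
  -- holonomy algebra
  have hinv : (loopHol U c' (idxReflSwap c.dir (r, σ, σ')))⁻¹ = holAt U (walk x' F) * holAt U (walk (walkEnd x' F) T) := by
    rw [hW, ← holAt_walk_wordRev, hclosed, hrev, walk_append, holAt_append]
  have hend : walkEnd (walkEnd x' F) T = x' := by
    rw [← walkEnd_append, ← hrev, ← hclosed, walkEnd_walkEnd_wordRev, hclosed]
  rw [hL, walk_append, holAt_append, hend, hinv, ← hA]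
  group

/-- The small-field condition is transported by a transverse centre reflection. [folklore] -/
theorem small_creflect_iff_of_ne (ρ : Fin P.d) (U : GaugeField P j G) (c : PBond P (j+1)) (h : c.dir ≠ ρ) :
    Small ℰ (U.creflect ρ) c ↔ Small ℰ U (crefBond ρ c) := by
  simp only [Small, loopHol_creflect_of_ne ρ U c h]
  exact ⟨fun h i => by simpa using h ((idxRefl ρ).symm i), fun h i => h _⟩

/-- The small-field condition is transported by the longitudinal centre reflection (`dist1` is a class function and inversion invariant). [folklore] -/
theorem small_creflect_iff_of_eq (ρ : Fin P.d) (U : GaugeField P j G) (c : PBond P (j+1)) (h : c.dir = ρ) :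
    Small ℰ (U.creflect ρ) c ↔ Small ℰ U (crefBond ρ c) := by
  simp only [Small, loopHol_creflect_of_eq ρ U c h]
  have key : ∀ X : G, dist1 ((axialAvg U (crefBond ρ c))⁻¹ * X⁻¹ * axialAvg U (crefBond ρ c)) = dist1 X := by
    intro X
    conv_lhs => rw [← inv_inv (axialAvg U (crefBond ρ c)), inv_inv (axialAvg U (crefBond ρ c))⁻¹]
    rw [GaugeGroup.dist1_conj, GaugeGroup.dist1_inv]
  simp only [key]
  exact ⟨fun h i => by simpa using h ((idxReflSwap ρ).symm i), fun h i => h _⟩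

/-- Transverse reflection of the correction factor ((0.7) as reindexing invariance). [cite: Balaban1987RG1, (0.7) p.253] -/
theorem corr_creflect_of_ne (ρ : Fin P.d) (U : GaugeField P j G) (c : PBond P (j+1)) (h : c.dir ≠ ρ) :
    corr ℰ (U.creflect ρ) c = corr ℰ U (crefBond ρ c) := by
  by_cases hs : Small ℰ U (crefBond ρ c)
  · have hs' := (small_creflect_iff_of_ne ℰ ρ U c h).mpr hs
    unfold corr
    rw [if_pos hs', if_pos hs]
    have : loopHol (U.creflect ρ) c = loopHol U (crefBond ρ c) ∘ idxRefl ρ := funext (loopHol_creflect_of_ne ρ U c h)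
    rw [this, ℰ.avg_reindex _ hs]
  · have hs' : ¬ Small ℰ (U.creflect ρ) c := fun h'' => hs ((small_creflect_iff_of_ne ℰ ρ U c h).mp h'')
    unfold corr
    rw [if_neg hs', if_neg hs]

/-- Longitudinal reflection of the correction factor: `corr (c_ρ U) c = U(c′)⁻¹ (corr U c′)⁻¹ U(c′)` ((0.5), (0.6), (0.7)). [cite: Balaban1987RG1, (0.5) p.253] -/
theorem corr_creflect_of_eq (ρ : Fin P.d) (U : GaugeField P j G) (c : PBond P (j+1)) (h : c.dir = ρ) :
    corr ℰ (U.creflect ρ) c = (axialAvg U (crefBond ρ c))⁻¹ * (corr ℰ U (crefBond ρ c))⁻¹ * axialAvg U (crefBond ρ c) := by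
  set A := axialAvg U (crefBond ρ c) with hA
  by_cases hs : Small ℰ U (crefBond ρ c)
  · have hs' := (small_creflect_iff_of_eq ℰ ρ U c h).mpr hs
    unfold corr
    rw [if_pos hs', if_pos hs]
    have hfam : loopHol (U.creflect ρ) c =
        fun i => A⁻¹ * ((fun k => ((loopHol U (crefBond ρ c) ∘ idxReflSwap ρ) k)⁻¹) i) * (A⁻¹)⁻¹ := by
      funext i
      rw [loopHol_creflect_of_eq ρ U c h, inv_inv]
      rfl
    have hsw : ∀ i, dist1 ((loopHol U (crefBond ρ c) ∘ idxReflSwap ρ) i) < ℰ.δ := fun i => hs _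
    have hswi : ∀ i, dist1 ((fun k => ((loopHol U (crefBond ρ c) ∘ idxReflSwap ρ) k)⁻¹) i) < ℰ.δ := fun i => by
      simp only [GaugeGroup.dist1_inv]; exact hs _
    rw [hfam, ℰ.avg_conj _ hswi, ℰ.avg_inv _ hsw, ℰ.avg_reindex _ hs, inv_inv]
  · have hs' : ¬ Small ℰ (U.creflect ρ) c := fun h'' => hs ((small_creflect_iff_of_eq ℰ ρ U c h).mp h'')
    unfold corr
    rw [if_neg hs', if_neg hs]
    group

/-- **THE TOTAL BLOCK AVERAGING COMMUTES WITH THE CENTRE REFLECTIONS**: `avg (c_ρ U) = c_ρ (avg U)` (the shape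
`AvgReflEquivariant` of `T4Covariance`, at one level): transversally loop by loop; longitudinally because the reflected loop is
the exchanged loop at the reflected bond traversed backwards from the other centre, and (0.5)–(0.7). [cite: Balaban1987RG1, (2.17) p.269] -/
theorem avgFun_creflect (ρ : Fin P.d) (U : GaugeField P j G) :
    avgFun ℰ (U.creflect ρ) = (avgFun ℰ U).creflect ρ := by
  funext c
  rw [GaugeField.creflect_eq ρ (avgFun ℰ U), GaugeField.reflect_apply, GaugeField.translate_apply]
  have hax : axialAvg (U.creflect ρ) c = ((axialAvg U).creflect ρ) c := by rw [axialAvg_creflect]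
  rw [GaugeField.creflect_eq ρ (axialAvg U), GaugeField.reflect_apply, GaugeField.translate_apply] at hax
  by_cases h : c.dir = ρ
  · rw [if_pos h] at hax ⊢
    show corr ℰ (U.creflect ρ) c * axialAvg (U.creflect ρ) c = (corr ℰ U (crefBond ρ c) * axialAvg U (crefBond ρ c))⁻¹
    rw [hax, corr_creflect_of_eq ℰ ρ U c h]
    show (axialAvg U (crefBond ρ c))⁻¹ * (corr ℰ U (crefBond ρ c))⁻¹ * axialAvg U (crefBond ρ c) *
        (axialAvg U (crefBond ρ c))⁻¹ = (corr ℰ U (crefBond ρ c) * axialAvg U (crefBond ρ c))⁻¹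
    group
  · rw [if_neg h] at hax ⊢
    show corr ℰ (U.creflect ρ) c * axialAvg (U.creflect ρ) c = corr ℰ U (crefBond ρ c) * axialAvg U (crefBond ρ c)
    rw [hax, corr_creflect_of_ne ℰ ρ U c h]
    rfl

/-! ### the `Averaging`-level statements -/

/-- `Averaging`-level form of `avgFun_permute`. [cite: Balaban1987RG1, (2.17) p.269] -/
theorem blockAvg_permute (π : Equiv.Perm (Fin P.d)) (U : GaugeField P j G) :
    (blockAvg ℰ : Averaging P j G).avg (U.permute π) = ((blockAvg ℰ : Averaging P j G).avg U).permute π :=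
  avgFun_permute ℰ π U

/-- `Averaging`-level form of `avgFun_translate`. [cite: Balaban1987RG1, (2.17) p.269] -/
theorem blockAvg_translate (a : Site P (j+1)) (U : GaugeField P j G) :
    (blockAvg ℰ : Averaging P j G).avg (U.translate (Site.scale a)) = ((blockAvg ℰ : Averaging P j G).avg U).translate a :=
  avgFun_translate ℰ a U

/-- `Averaging`-level form of `avgFun_creflect`. [cite: Balaban1987RG1, (2.17) p.269] -/
theorem blockAvg_creflect (ρ : Fin P.d) (U : GaugeField P j G) :
    (blockAvg ℰ : Averaging P j G).avg (U.creflect ρ) = ((blockAvg ℰ : Averaging P j G).avg U).creflect ρ :=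
  avgFun_creflect ℰ ρ U

/-! ## 5. Measurability (`T4Continuum.FiniteEpsData.AvgMeasurable`) -/

section Measurability

variable [MeasurableSpace G] [RegularGaugeGroup G]

/-- The loop variables are measurable in `U`. [folklore] -/
theorem measurable_loopHol (c : PBond P (j+1)) : Measurable (fun U : GaugeField P j G => loopHol U c) :=
  measurable_pi_lambda _ fun _ => measurable_holAt _

/-- The small-field domain at `c` is a measurable set (`RegularGaugeGroup.measurable_dist1`). [folklore] -/
theorem measurableSet_small (c : PBond P (j+1)) : MeasurableSet {U : GaugeField P j G | Small ℰ U c} := by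
  have : {U : GaugeField P j G | Small ℰ U c} = ⋂ i, {U : GaugeField P j G | dist1 (loopHol U c i) < ℰ.δ} := by
    ext U; simp [Small]
  rw [this]
  exact MeasurableSet.iInter fun i =>
    measurableSet_lt (RegularGaugeGroup.measurable_dist1.comp ((measurable_pi_apply i).comp (measurable_loopHol c)))
      measurable_const

/-- The correction factor is measurable when the small-loop average `E` is. [folklore] -/
theorem measurable_corr (hE : ∀ n, Measurable (fun W : Fin (n+1) → G => ℰ.E W)) (c : PBond P (j+1)) :
    Measurable (fun U : GaugeField P j G => corr ℰ U c) := by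
  unfold corr
  exact Measurable.ite (measurableSet_small ℰ c) ((ℰ.measurable_avg hE).comp (measurable_loopHol c)) measurable_const

/-- **MEASURABILITY of the total block averaging** (given a measurable small-loop average). [folklore] -/
theorem measurable_avgFun (hE : ∀ n, Measurable (fun W : Fin (n+1) → G => ℰ.E W)) :
    Measurable (avgFun ℰ : GaugeField P j G → GaugeField P (j+1) G) :=
  measurable_pi_iff.mpr fun c => (measurable_corr ℰ hE c).mul ((measurable_pi_apply c).comp measurable_axialAvg)

end Measurability

end BlockAveraging

/-! ## 6. Discharge of the four named hypotheses of `T4Continuum` / `T4Covariance` for approximations averaging by (0.4) -/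

namespace T4Continuum.FiniteEpsData

variable {F : T4Family} {G : Type*} [GaugeGroup G] [MeasurableSpace G] [HaarData G]

/-- `AvgPermEquivariant` HOLDS for every finite-`ε` approximation whose averaging maps are the (0.4)-shaped block averaging
`blockAvg ℰ`, for EVERY small-loop average `ℰ` (every level `K, j`; the printed inner operation is the inhabitant `expMeanLogSU/U`
of `BlockAveragingExpMeanLog`). [cite: Balaban1987RG1, (0.4) p.253] -/
theorem avgPermEquivariant_of_blockAvg (D : FiniteEpsData F G) (ℰ : LoopAverage G)
    (h : ∀ K j, D.av K j = BlockAveraging.blockAvg ℰ) : D.AvgPermEquivariant := by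
  intro K j π U
  rw [h K j]
  exact BlockAveraging.avgFun_permute ℰ π U

/-- `AvgTranslEquivariant` HOLDS for every approximation averaging by `blockAvg ℰ`, every small-loop average `ℰ`.
[cite: Balaban1987RG1, (0.4) p.253] -/
theorem avgTranslEquivariant_of_blockAvg (D : FiniteEpsData F G) (ℰ : LoopAverage G)
    (h : ∀ K j, D.av K j = BlockAveraging.blockAvg ℰ) : D.AvgTranslEquivariant := by
  intro K j a U
  rw [h K j]
  exact BlockAveraging.avgFun_translate ℰ a U

/-- `AvgReflEquivariant` HOLDS for every approximation averaging by `blockAvg ℰ`, every small-loop average `ℰ`.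
[cite: Balaban1987RG1, (0.4) p.253] -/
theorem avgReflEquivariant_of_blockAvg (D : FiniteEpsData F G) (ℰ : LoopAverage G)
    (h : ∀ K j, D.av K j = BlockAveraging.blockAvg ℰ) : D.AvgReflEquivariant := by
  intro K j ρ U
  rw [h K j]
  exact BlockAveraging.avgFun_creflect ℰ ρ U

/-- `AvgMeasurable` HOLDS for every approximation averaging by `blockAvg ℰ` with a MEASURABLE small-loop average `ℰ`, over a
`RegularGaugeGroup` (e.g. `U(N)`, `SU(N)` of `UnitaryModel`; for `ℰ = expMeanLogSU/U` and `ℰ = su2Mean` the measurability is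
discharged in the sibling modules). [cite: Balaban1987RG1, (0.4) p.253] -/
theorem avgMeasurable_of_blockAvg [RegularGaugeGroup G] (D : FiniteEpsData F G) (ℰ : LoopAverage G)
    (hE : ∀ n, Measurable (fun W : Fin (n+1) → G => ℰ.E W)) (h : ∀ K j, D.av K j = BlockAveraging.blockAvg ℰ) :
    D.AvgMeasurable := by
  intro K j
  rw [h K j]
  exact BlockAveraging.measurable_avgFun ℰ hE

/-- Hence, for approximations averaging by `blockAvg ℰ` (any small-loop average `ℰ`): the torus-covariance targets
`limit_torusCovariant'`, `limit_torusCovariant` of `T4Continuum` HOLD outright (`T4Covariance.avg_limit_torusCovariant` with its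
three hypotheses discharged). [folklore] -/
theorem limit_torusCovariant_of_blockAvg [MeasurableInv G] (D : FiniteEpsData F G) (ℰ : LoopAverage G)
    (h : ∀ K j, D.av K j = BlockAveraging.blockAvg ℰ) : D.limit_torusCovariant' ∧ D.limit_torusCovariant :=
  D.avg_limit_torusCovariant (D.avgPermEquivariant_of_blockAvg ℰ h) (D.avgTranslEquivariant_of_blockAvg ℰ h)
    (D.avgReflEquivariant_of_blockAvg ℰ h)

end T4Continuum.FiniteEpsData

end Literature.MathematicalPhysics.QuantumFieldTheory.Balaban1983to89
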